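import Summits.QuantumFields.QCD.Theorems.NestedDissectionSeaCoerciveOfDiluteLineDefs
import Literature.MathematicalPhysics.QuantumFieldTheory.QCDPhaseQuenched

/-!
# Crux `CoerciveOfDilute` (stmt-QuantumFields-14759), line `Sketch`: stub `stub_sheetGreenIntegrable`

The bookkeeping statement `SheetGreenIntegrable` of the line `Sketch` of the crux
`Summit.QuantumFields.QCD.Theses.NestedDissectionSea.CoerciveOfDilute` (vocabulary module
`…NestedDissectionSeaCoerciveOfDiluteLineDefs`): for the torus quark propagator compressed to the internal
separator of a window box, `G(U) = torusSheetGreen U μ s = (D_T(U, μ)⁻¹)_ΣΣ` (Mathlib's nonsingular inverse of the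
full periodic `r = 1` Wilson–Dirac matrix, fundamental `SU(3)`; `ℓ²` operator norm),

* (a) `U ↦ ‖G(U)‖` is a measurable function of the gauge field, for every bare mass `μ`;
* (b) at a SEA mass `μ = m_f` the phase-quenched integrand `‖G(U)‖ · ∏_{f'} |det D_T(U, m_{f'})|` is integrable
  against the Wilson measure.

Proof. `D⁻¹ = (det D)⁻¹ • adj D` (`Matrix.inv_def`; the junk inverse `0` at `det D = 0` is the case
`(0 : ℂ)⁻¹ = 0`), and `toBlock` commutes with scalars, so `‖G(U)‖ = |det D_T(μ)|⁻¹ · ‖(adj D_T(μ))_ΣΣ‖`. The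
compressed adjugate is polynomial, hence continuous, in the link variables (`continuous_wilsonDirac`,
`Continuous.matrix_adjugate`; the `ℓ²`-operator normed group on matrices carries the product topology), which gives
(a). For (b), `‖G(U)‖ · |det D_T(m_f)| ≤ ‖(adj D_T(m_f))_ΣΣ‖` (equality off `{det = 0}`, `0 ≤ ·` on it), so the
integrand is dominated by the continuous function `‖(adj D_T(m_f))_ΣΣ‖ · ∏_{f' ≠ f} |det D_T(m_{f'})|` on the
compact configuration space `SU(3)^{edges}`: bounded and measurable on a probability space, hence integrable
(`Integrable.of_bound`). [folklore]
-/

noncomputable section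

open scoped BigOperators Classical Matrix.Norms.L2Operator
open MeasureTheory Filter Matrix
open Literature.MathematicalPhysics.QuantumLattice Literature.MathematicalPhysics.QuantumFieldTheory
  Literature.Probability.LatticeModels

namespace Summit.QuantumFields.QCD.Cruxes.CoerciveOfDilute.SeaPaysPoles

section Helpers

variable {N : ℕ} [NeZero N]

omit [NeZero N] in
/-- The torus Wilson–Dirac matrix `D_T(U, μ)` (fundamental `SU(3)`, `r = 1`) depends continuously on the gauge
field. [folklore] -/
private theorem sheetGreenIntegrable_continuous_wilsonDirac (μ : ℝ) :
    Continuous fun U : GaugeConfig 4 N SU3 => wilsonDirac (fundamentalRep (Fin 3)) U μ 1 :=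
  continuous_wilsonDirac (fundamentalRep (Fin 3)) (continuous_fundamentalRep (Fin 3)) μ 1

/-- The compressed adjugate `(adj D_T(U, μ))_ΣΣ` depends continuously on the gauge field (its entries are
cofactors, polynomial in the link entries). [folklore] -/
private theorem sheetGreenIntegrable_continuous_adjugate_toBlock (μ : ℝ) (s : Fin 4 → ℕ) :
    Continuous fun U : GaugeConfig 4 N SU3 =>
      (wilsonDirac (fundamentalRep (Fin 3)) U μ 1).adjugate.toBlock (sheet s) (sheet s) := by
  refine continuous_pi fun i => continuous_pi fun j => ?_
  simp only [Matrix.toBlock_apply]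
  exact (sheetGreenIntegrable_continuous_wilsonDirac μ).matrix_adjugate.matrix_elem _ _

/-- `(D_T⁻¹)_ΣΣ = (det D_T)⁻¹ • (adj D_T)_ΣΣ` (valid also at `det D_T = 0`, both sides being `0`). [folklore] -/
private theorem sheetGreenIntegrable_torusSheetGreen_eq_smul (U : GaugeConfig 4 N SU3) (μ : ℝ) (s : Fin 4 → ℕ) :
    torusSheetGreen U μ s = ((wilsonDirac (fundamentalRep (Fin 3)) U μ 1).det)⁻¹ •
      (wilsonDirac (fundamentalRep (Fin 3)) U μ 1).adjugate.toBlock (sheet s) (sheet s) := by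
  unfold torusSheetGreen
  rw [Matrix.inv_def, Ring.inverse_eq_inv']
  ext i j
  simp only [Matrix.toBlock_apply, Matrix.smul_apply]

/-- `‖(D_T⁻¹)_ΣΣ‖ = |det D_T|⁻¹ · ‖(adj D_T)_ΣΣ‖` in the `ℓ²` operator norm. [folklore] -/
private theorem sheetGreenIntegrable_norm_torusSheetGreen_eq (U : GaugeConfig 4 N SU3) (μ : ℝ) (s : Fin 4 → ℕ) :
    ‖torusSheetGreen U μ s‖ = ‖(wilsonDirac (fundamentalRep (Fin 3)) U μ 1).det‖⁻¹ *
      ‖(wilsonDirac (fundamentalRep (Fin 3)) U μ 1).adjugate.toBlock (sheet s) (sheet s)‖ := by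
  rw [sheetGreenIntegrable_torusSheetGreen_eq_smul, norm_smul, norm_inv]

/-- **(a)** `U ↦ ‖(D_T(U, μ)⁻¹)_ΣΣ‖` is measurable. [folklore] -/
private theorem sheetGreenIntegrable_measurable_norm_torusSheetGreen (μ : ℝ) (s : Fin 4 → ℕ) :
    Measurable fun U : GaugeConfig 4 N SU3 => ‖torusSheetGreen U μ s‖ := by
  have h : (fun U : GaugeConfig 4 N SU3 => ‖torusSheetGreen U μ s‖) = fun U =>
      ‖(wilsonDirac (fundamentalRep (Fin 3)) U μ 1).det‖⁻¹ *
        ‖(wilsonDirac (fundamentalRep (Fin 3)) U μ 1).adjugate.toBlock (sheet s) (sheet s)‖ :=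
    funext fun U => sheetGreenIntegrable_norm_torusSheetGreen_eq U μ s
  rw [h]
  exact ((sheetGreenIntegrable_continuous_wilsonDirac μ).matrix_det.norm.measurable.inv).mul
    (sheetGreenIntegrable_continuous_adjugate_toBlock μ s).norm.measurable

/-- Pole pre-payment: `‖(D_T⁻¹)_ΣΣ‖ · |det D_T| ≤ ‖(adj D_T)_ΣΣ‖` (equality off `{det D_T = 0}`). [folklore] -/
private theorem sheetGreenIntegrable_norm_mul_norm_det_le (U : GaugeConfig 4 N SU3) (μ : ℝ) (s : Fin 4 → ℕ) :
    ‖torusSheetGreen U μ s‖ * ‖(wilsonDirac (fundamentalRep (Fin 3)) U μ 1).det‖ ≤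
      ‖(wilsonDirac (fundamentalRep (Fin 3)) U μ 1).adjugate.toBlock (sheet s) (sheet s)‖ := by
  rw [sheetGreenIntegrable_norm_torusSheetGreen_eq]
  by_cases hdet : (wilsonDirac (fundamentalRep (Fin 3)) U μ 1).det = 0
  · rw [hdet, norm_zero, mul_zero]
    exact norm_nonneg _
  · rw [mul_comm ‖_‖⁻¹, mul_assoc, inv_mul_cancel₀ (norm_ne_zero_iff.mpr hdet), mul_one]

/-- **(b)** At a sea mass the phase-quenched integrand `‖(D_T(m_f)⁻¹)_ΣΣ‖ · ∏_{f'} |det D_T(m_{f'})|` is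
integrable against the Wilson measure (bounded by a continuous function on the compact configuration space).
[folklore] -/
private theorem sheetGreenIntegrable_integrable (β : ℝ) (Nf : ℕ) (mq : Fin Nf → ℝ) (s : Fin 4 → ℕ) (f : Fin Nf) :
    Integrable (fun U : GaugeConfig 4 N SU3 =>
        ‖torusSheetGreen U (mq f) s‖ * ∏ f', ‖fermionDet (wilsonDirac (fundamentalRep (Fin 3)) U (mq f') 1)‖)
      (wilsonMeasure (d := 4) (L := N) (fundamentalRep (Fin 3)) β) := by
  -- the continuous dominating function
  set g : GaugeConfig 4 N SU3 → ℝ := fun U =>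
    ‖(wilsonDirac (fundamentalRep (Fin 3)) U (mq f) 1).adjugate.toBlock (sheet s) (sheet s)‖ *
      ∏ f' ∈ Finset.univ.erase f, ‖fermionDet (wilsonDirac (fundamentalRep (Fin 3)) U (mq f') 1)‖ with hg_def
  have hg : Continuous g :=
    (sheetGreenIntegrable_continuous_adjugate_toBlock (mq f) s).norm.mul
      (continuous_finsetProd _ fun f' _ => (sheetGreenIntegrable_continuous_wilsonDirac (mq f')).matrix_det.norm)
  obtain ⟨C, hC⟩ : ∃ C : ℝ, ∀ U, g U ≤ C := by
    obtain ⟨C, hC⟩ := isCompact_univ.bddAbove_image hg.continuousOn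
    exact ⟨C, fun U => hC ⟨U, Set.mem_univ _, rfl⟩⟩
  have hmeas : Measurable fun U : GaugeConfig 4 N SU3 =>
      ‖torusSheetGreen U (mq f) s‖ * ∏ f', ‖fermionDet (wilsonDirac (fundamentalRep (Fin 3)) U (mq f') 1)‖ :=
    (sheetGreenIntegrable_measurable_norm_torusSheetGreen (mq f) s).mul
      (Finset.measurable_prod _ fun f' _ =>
        (sheetGreenIntegrable_continuous_wilsonDirac (mq f')).matrix_det.norm.measurable)
  have hle : ∀ U : GaugeConfig 4 N SU3,
      ‖torusSheetGreen U (mq f) s‖ * ∏ f', ‖fermionDet (wilsonDirac (fundamentalRep (Fin 3)) U (mq f') 1)‖ ≤ g U := by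
    intro U
    rw [← Finset.mul_prod_erase Finset.univ _ (Finset.mem_univ f), ← mul_assoc]
    exact mul_le_mul_of_nonneg_right (sheetGreenIntegrable_norm_mul_norm_det_le U (mq f) s)
      (Finset.prod_nonneg fun _ _ => norm_nonneg _)
  refine Integrable.of_bound hmeas.aestronglyMeasurable C (Eventually.of_forall fun U => ?_)
  rw [Real.norm_eq_abs, abs_of_nonneg (mul_nonneg (norm_nonneg _) (Finset.prod_nonneg fun _ _ => norm_nonneg _))]
  exact (hle U).trans (hC U)

end Helpers

/-- **`SheetGreenIntegrable`** (registered stub `stub_sheetGreenIntegrable` of line `Sketch`, crux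
stmt-QuantumFields-14759): (a) the `ℓ²` operator norm of the compressed torus propagator `(D_T(μ)⁻¹)_ΣΣ` is a
measurable function of the gauge field; (b) at a sea mass `m_f` the integrand `‖(D_T(m_f)⁻¹)_ΣΣ‖ · ∏_{f'} |det D_T(m_{f'})|`
is integrable against the Wilson measure — the pole at `{det D_T(m_f) = 0}` is pre-paid by the determinant factor
(`|det D| · D⁻¹ = adj D`, polynomial in the bounded link entries; Mathlib's inverse is `0` on `{det = 0}`). [folklore] -/
theorem stub_sheetGreenIntegrable : SheetGreenIntegrable :=
  ⟨fun _N _ μ s => sheetGreenIntegrable_measurable_norm_torusSheetGreen μ s,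
    fun _N _ β Nf mq s f => sheetGreenIntegrable_integrable β Nf mq s f⟩

end Summit.QuantumFields.QCD.Cruxes.CoerciveOfDilute.SeaPaysPoles

end
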